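import Literature.Probability.Percolation.AnnulusCircuits
import Literature.Topology.PlaneTopology.JordanCurve
import Mathlib.Analysis.Normed.Module.Connected
import HarnessLib

/-!
# Enclosing circuits meet connecting sets (elementary planar topology of `A(l)`)

Topic: Probability/Percolation (companion to `AnnulusCircuits.lean`). For Grimmett's event
`O(l)` — an open circuit of the annulus `A(l) = B(3l) ∖ B(l)` with the origin in its inside
(`Literature.Probability.Percolation.openCircuitAround`, `Literature.Probability.Percolation.EnclosesOrigin`; Grimmett, *Percolation*,
2nd ed. (1999), §11.7, (11.70)–(11.72)) — the only geometric property that RSW/FKG "circuit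
chaining" arguments use is: *every connected planar set joining a point near the origin to a
point far away meets the trace of the circuit*. We prove this here from the definitions, with no
appeal to the Jordan curve theorem:

* `walkTrace_subset_of_support_subset`: the trace of a walk of `A(l)` lies in the closed planar
  annulus `{l + 1 ≤ ‖z‖ ≤ 3√2 · l}`;
* `ball_subset_connectedComponentIn_compl_walkTrace`: the disc `‖z‖ < l + 1` lies in the
  component of the origin in the complement of the trace;
* `not_mem_connectedComponentIn_of_lt_norm`: points with `‖z‖ > 3√2 · l` are not enclosed;
* `EnclosesOrigin.inter_walkTrace_nonempty`: a preconnected set containing a point with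
  `‖p‖ < l + 1` and a point with `‖q‖ > 3√2 · l` meets the trace of an enclosing walk.

These serve the (folklore) RSW corollary on crossings of conformal rectangles
(`Literature.Probability.Percolation.discreteCrossingProb_clusterPt_mem_Ioo` and its corrected form), where open
circuits in annuli around boundary points are chained with tube crossings.

Mathlib anchors: `connectedComponentIn`, `IsPreconnected.subset_connectedComponentIn`,
`Metric.ball`, `Convex.segment_subset`; H21 anchors: `annulus`, `edgeTrace`, `walkTrace`,
`EnclosesOrigin` (`AnnulusCircuits.lean`), `isConnected_setOf_lt_norm`,
`not_isBounded_setOf_lt_norm` (`Literature/Topology/PlaneTopology/JordanCurve.lean`).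

## References
* G. Grimmett, *Percolation*, 2nd ed., Springer (1999), §11.7. [GrimmettPercolation1999]
-/


namespace Literature.Probability.Percolation

open Set Metric

/-! ### Enclosing circuits meet connecting sets (elementary topology, no Jordan curve theorem) -/

/-- Sites of the annulus `A(l)` have both coordinates of absolute value at most `3l` and some
coordinate of absolute value at least `l + 1`. [folklore] -/
theorem abs_le_and_exists_le_abs_of_mem_annulus {l : ℕ} {x : LatticeModels.Site 2}
    (hx : x ∈ LatticeModels.annulus 2 l (3 * l)) : (∀ i, |x i| ≤ 3 * l) ∧ ∃ i, (l : ℤ) + 1 ≤ |x i| := by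
  simp only [LatticeModels.mem_annulus, LatticeModels.mem_box, not_forall, not_and_or, not_le] at hx
  obtain ⟨hbig, i, hi⟩ := hx
  refine ⟨fun i => abs_le.2 ⟨by have := (hbig i).1; omega, by have := (hbig i).2; omega⟩, i, ?_⟩
  rcases hi with hi | hi
  · rw [abs_of_neg (by omega)]; omega
  · rw [abs_of_pos (by omega)]; omega

/-- Two adjacent sites of `A(l)` share a coordinate direction `k` and a sign `s = ±1` with
`s · x_k ≥ l + 1` and `s · y_k ≥ l + 1` (the edge stays in one of the four half-planes
`{±re ≥ l+1}`, `{±im ≥ l+1}`). [folklore] -/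
theorem exists_coord_of_adj_of_mem_annulus {l : ℕ} {x y : LatticeModels.Site 2} (hxy : (LatticeModels.zdGraph 2).Adj x y)
    (hx : x ∈ LatticeModels.annulus 2 l (3 * l)) (hy : y ∈ LatticeModels.annulus 2 l (3 * l)) :
    ∃ (k : Fin 2) (s : ℤ), (s = 1 ∨ s = -1) ∧ (l : ℤ) + 1 ≤ s * x k ∧ (l : ℤ) + 1 ≤ s * y k := by
  -- adjacency: `y = x ± e_i`
  have hadj : ∃ (i : Fin 2) (t : ℤ), (t = 1 ∨ t = -1) ∧ ∀ j, y j = x j + (if j = i then t else 0) := by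
    obtain ⟨i, h | h⟩ := (LatticeModels.zdGraph_adj_iff x y).1 hxy
    · refine ⟨i, 1, Or.inl rfl, fun j => ?_⟩
      rw [h, Pi.add_apply, Pi.single_apply]
    · refine ⟨i, -1, Or.inr rfl, fun j => ?_⟩
      rw [h, Pi.add_apply, Pi.single_apply]
      split_ifs <;> ring
  obtain ⟨i, t, ht, hj⟩ := hadj
  obtain ⟨-, k, hk⟩ := abs_le_and_exists_le_abs_of_mem_annulus hx
  obtain ⟨-, k', hk'⟩ := abs_le_and_exists_le_abs_of_mem_annulus hy
  -- a coordinate `m` that is large for both endpoints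
  obtain ⟨m, hmx, hmy⟩ : ∃ m, (l : ℤ) + 1 ≤ |x m| ∧ (l : ℤ) + 1 ≤ |y m| := by
    by_cases hkm : (l : ℤ) + 1 ≤ |y k|
    · exact ⟨k, hk, hkm⟩
    · refine ⟨k', ?_, hk'⟩
      have hyk := hj k
      have hyk' := hj k'
      by_cases hki : k = i
      · subst hki
        have hk'i : k' ≠ k := by rintro rfl; exact hkm hk'
        rw [if_neg hk'i, add_zero] at hyk'
        rwa [← hyk']
      · rw [if_neg hki, add_zero] at hyk
        rw [hyk] at hkm
        exact absurd hk hkm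
  have hym := hj m
  refine ⟨m, if 0 ≤ x m then 1 else -1, by split_ifs <;> simp, ?_, ?_⟩
  · split_ifs with h0
    · rw [abs_of_nonneg h0] at hmx; linarith
    · rw [abs_of_neg (not_le.1 h0)] at hmx; linarith
  · have hclose : |x m - y m| ≤ 1 := by
      rw [hym]; split_ifs <;> rcases ht with rfl | rfl <;> simp
    split_ifs with h0
    · rw [abs_of_nonneg h0] at hmx
      rcases le_or_gt 0 (y m) with h1 | h1
      · rw [abs_of_nonneg h1] at hmy; linarith
      · rw [abs_of_neg h1] at hmy
        rw [abs_le] at hclose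
        omega
    · rw [abs_of_neg (not_le.1 h0)] at hmx
      rcases le_or_gt 0 (y m) with h1 | h1
      · rw [abs_of_nonneg h1] at hmy
        rw [abs_le] at hclose
        omega
      · rw [abs_of_neg h1] at hmy; linarith

/-- A point on the trace of an edge joining two sites of `A(l)` has norm at least `l + 1`.
[folklore] -/
theorem le_norm_of_mem_edgeTrace {l : ℕ} {x y : LatticeModels.Site 2} (hxy : (LatticeModels.zdGraph 2).Adj x y)
    (hx : x ∈ LatticeModels.annulus 2 l (3 * l)) (hy : y ∈ LatticeModels.annulus 2 l (3 * l)) {z : ℂ}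
    (hz : z ∈ edgeTrace s(x, y)) : (l : ℝ) + 1 ≤ ‖z‖ := by
  obtain ⟨k, s, hs, hxk, hyk⟩ := exists_coord_of_adj_of_mem_annulus hxy hx hy
  rw [edgeTrace_mk] at hz
  obtain ⟨a, b, ha, hb, hab, rfl⟩ := hz
  -- the `k`-th coordinate functional
  let φ : ℂ → ℝ := fun w => if k = 0 then w.re else w.im
  have hφx : ∀ u : LatticeModels.Site 2, φ (LatticeModels.Site.toComplex u) = u k := by
    intro u
    fin_cases k <;> simp [φ, LatticeModels.Site.toComplex]
  have hφlin : φ (a • LatticeModels.Site.toComplex x + b • LatticeModels.Site.toComplex y) =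
      a * φ (LatticeModels.Site.toComplex x) + b * φ (LatticeModels.Site.toComplex y) := by
    fin_cases k <;> simp [φ]
  have hφle : ∀ w : ℂ, |φ w| ≤ ‖w‖ := by
    intro w
    fin_cases k
    · simpa [φ] using Complex.abs_re_le_norm w
    · simpa [φ] using Complex.abs_im_le_norm w
  have hxk' : (l : ℝ) + 1 ≤ s * φ (LatticeModels.Site.toComplex x) := by rw [hφx]; exact_mod_cast hxk
  have hyk' : (l : ℝ) + 1 ≤ s * φ (LatticeModels.Site.toComplex y) := by rw [hφx]; exact_mod_cast hyk
  have habs : |(s : ℝ)| = 1 := by rcases hs with rfl | rfl <;> simp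
  calc (l : ℝ) + 1 = a * ((l : ℝ) + 1) + b * ((l : ℝ) + 1) := by rw [← add_mul, hab, one_mul]
    _ ≤ a * (s * φ (LatticeModels.Site.toComplex x)) + b * (s * φ (LatticeModels.Site.toComplex y)) := by gcongr
    _ = s * φ (a • LatticeModels.Site.toComplex x + b • LatticeModels.Site.toComplex y) := by rw [hφlin]; ring
    _ ≤ |(s : ℝ) * φ (a • LatticeModels.Site.toComplex x + b • LatticeModels.Site.toComplex y)| := le_abs_self _
    _ = |φ (a • LatticeModels.Site.toComplex x + b • LatticeModels.Site.toComplex y)| := by rw [abs_mul, habs, one_mul]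
    _ ≤ _ := hφle _

/-- A point on the trace of an edge joining two sites of `A(l)` has norm at most `3√2 · l`
(both coordinates of both endpoints are at most `3l` in absolute value). [folklore] -/
theorem norm_le_of_mem_edgeTrace {l : ℕ} {x y : LatticeModels.Site 2}
    (hx : x ∈ LatticeModels.annulus 2 l (3 * l)) (hy : y ∈ LatticeModels.annulus 2 l (3 * l)) {z : ℂ}
    (hz : z ∈ edgeTrace s(x, y)) : ‖z‖ ≤ 3 * Real.sqrt 2 * l := by
  have hball : ∀ u : LatticeModels.Site 2, u ∈ LatticeModels.annulus 2 l (3 * l) →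
      LatticeModels.Site.toComplex u ∈ closedBall (0 : ℂ) (3 * Real.sqrt 2 * l) := by
    intro u hu
    obtain ⟨hle, -⟩ := abs_le_and_exists_le_abs_of_mem_annulus hu
    rw [mem_closedBall, dist_zero_right]
    have h0 : |(u 0 : ℝ)| ≤ 3 * l := by exact_mod_cast hle 0
    have h1 : |(u 1 : ℝ)| ≤ 3 * l := by exact_mod_cast hle 1
    have hu0 : (u 0 : ℝ) ^ 2 ≤ (3 * l) ^ 2 := by
      rw [← sq_abs]; exact pow_le_pow_left₀ (abs_nonneg _) h0 2
    have hu1 : (u 1 : ℝ) ^ 2 ≤ (3 * l) ^ 2 := by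
      rw [← sq_abs]; exact pow_le_pow_left₀ (abs_nonneg _) h1 2
    have hsq : ‖LatticeModels.Site.toComplex u‖ ^ 2 ≤ (3 * Real.sqrt 2 * l) ^ 2 := by
      rw [Complex.sq_norm, Complex.normSq_apply]
      simp only [LatticeModels.Site.toComplex_re, LatticeModels.Site.toComplex_im]
      have h2 : Real.sqrt 2 ^ 2 = 2 := Real.sq_sqrt (by norm_num)
      nlinarith [hu0, hu1, h2]
    exact (sq_le_sq₀ (norm_nonneg _) (by positivity)).1 hsq
  rw [edgeTrace_mk] at hz
  have := (convex_closedBall (0 : ℂ) (3 * Real.sqrt 2 * l)).segment_subset (hball x hx)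
    (hball y hy) hz
  rwa [mem_closedBall, dist_zero_right] at this

/-- The trace of a walk with all vertices in the annulus `A(l)` lies in the closed planar
annulus `{l + 1 ≤ ‖z‖ ≤ 3√2 l}`. [folklore] -/
theorem walkTrace_subset_of_support_subset {l : ℕ} {u v : LatticeModels.Site 2} {w : (LatticeModels.zdGraph 2).Walk u v}
    (hs : ∀ x ∈ w.support, x ∈ LatticeModels.annulus 2 l (3 * l)) :
    walkTrace w ⊆ {z : ℂ | (l : ℝ) + 1 ≤ ‖z‖ ∧ ‖z‖ ≤ 3 * Real.sqrt 2 * l} := by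
  intro z hz
  obtain ⟨e, he, hze⟩ := mem_walkTrace_iff.1 hz
  induction e using Sym2.ind with
  | h x y =>
    have hadj : (LatticeModels.zdGraph 2).Adj x y := w.adj_of_mem_edges he
    have hx := hs x (w.fst_mem_support_of_mem_edges he)
    have hy := hs y (w.snd_mem_support_of_mem_edges he)
    exact ⟨le_norm_of_mem_edgeTrace hadj hx hy hze, norm_le_of_mem_edgeTrace hx hy hze⟩

/-- The open disc of radius `l + 1` about the origin lies in the component of the origin in the
complement of the trace of a walk of `A(l)`. [folklore] -/
theorem ball_subset_connectedComponentIn_compl_walkTrace {l : ℕ} {u v : LatticeModels.Site 2}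
    {w : (LatticeModels.zdGraph 2).Walk u v} (hs : ∀ x ∈ w.support, x ∈ LatticeModels.annulus 2 l (3 * l)) :
    ball (0 : ℂ) ((l : ℝ) + 1) ⊆ connectedComponentIn (walkTrace w)ᶜ 0 := by
  refine (isConnected_ball (by positivity)).isPreconnected.subset_connectedComponentIn
    (mem_ball_self (by positivity)) fun z hz hzt => ?_
  have := (walkTrace_subset_of_support_subset hs hzt).1
  rw [mem_ball, dist_zero_right] at hz
  linarith

/-- Points of norm larger than `3√2 · l` are not enclosed by a walk of `A(l)` that encloses the
origin: the connected unbounded region `{3√2 l < ‖z‖}` misses the trace, so if it met the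
(bounded) component of the origin it would lie inside it. [folklore] -/
theorem not_mem_connectedComponentIn_of_lt_norm {l : ℕ} {u v : LatticeModels.Site 2}
    {w : (LatticeModels.zdGraph 2).Walk u v} (hs : ∀ x ∈ w.support, x ∈ LatticeModels.annulus 2 l (3 * l))
    (hw : EnclosesOrigin w) {z : ℂ} (hz : 3 * Real.sqrt 2 * l < ‖z‖) :
    z ∉ connectedComponentIn (walkTrace w)ᶜ 0 := by
  intro hzK
  set A : Set ℂ := {z : ℂ | 3 * Real.sqrt 2 * l < ‖z‖}
  have hA : A ⊆ connectedComponentIn (walkTrace w)ᶜ 0 := by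
    have hconn := (Literature.Topology.PlaneTopology.isConnected_setOf_lt_norm (R := 3 * Real.sqrt 2 * l) (by positivity))
    have hsub : A ⊆ (walkTrace w)ᶜ := fun y hy hyt =>
      absurd (walkTrace_subset_of_support_subset hs hyt).2 (not_le.2 hy)
    have := hconn.isPreconnected.subset_connectedComponentIn (x := z) hz hsub
    rwa [← connectedComponentIn_eq hzK] at this
  exact Literature.Topology.PlaneTopology.not_isBounded_setOf_lt_norm _ (hw.2.subset hA)

/-- **An enclosing circuit is crossed by every connected set joining the inside to far away.**
If a walk `w` of the annulus `A(l)` encloses the origin, then every connected planar set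
containing a point of the disc `‖z‖ < l + 1` and a point with `‖z‖ > 3√2 · l` meets the trace of
`w`. This is the only property of "circuit around the origin" used by RSW-type arguments, and it
needs no Jordan curve theorem. [folklore] -/
theorem EnclosesOrigin.inter_walkTrace_nonempty {l : ℕ} {u v : LatticeModels.Site 2}
    {w : (LatticeModels.zdGraph 2).Walk u v} (hs : ∀ x ∈ w.support, x ∈ LatticeModels.annulus 2 l (3 * l))
    (hw : EnclosesOrigin w) {S : Set ℂ} (hS : IsPreconnected S) {p q : ℂ} (hp : p ∈ S)
    (hpn : ‖p‖ < (l : ℝ) + 1) (hq : q ∈ S) (hqn : 3 * Real.sqrt 2 * l < ‖q‖) :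
    (S ∩ walkTrace w).Nonempty := by
  by_contra h
  rw [Set.not_nonempty_iff_eq_empty] at h
  have hsub : S ⊆ (walkTrace w)ᶜ := fun z hz hzt => by
    have : z ∈ S ∩ walkTrace w := ⟨hz, hzt⟩
    rw [h] at this
    exact this
  have hpK : p ∈ connectedComponentIn (walkTrace w)ᶜ 0 :=
    ball_subset_connectedComponentIn_compl_walkTrace hs (by rwa [mem_ball, dist_zero_right])
  have hSK : S ⊆ connectedComponentIn (walkTrace w)ᶜ 0 := by
    have := hS.subset_connectedComponentIn hp hsub
    rwa [← connectedComponentIn_eq hpK] at this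
  exact not_mem_connectedComponentIn_of_lt_norm hs hw hqn (hSK hq)

end Literature.Probability.Percolation
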